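import Literature.Geometry.Symplectic.OrigamiMoserFieldLocal
import Literature.Topology.FourManifolds.SlabFlow
import Literature.Geometry.Manifold.TimeDependentFlowIcc
import Mathlib.Analysis.SpecialFunctions.SmoothTransition
import Mathlib.Topology.MetricSpace.Thickening
import HarnessLib

/-!
# The origami Moser argument, VI: the cut-off Moser field generates an isotopy fixing the fold

Sixth file of the proof of the named fact `Literature.Geometry.Symplectic.exists_origamiCollarNormalForm`
(Cannas da Silva–Guillemin–Woodward 2000, Thm. 1).  For Moser data `D` on the collar `N × ℝ` of a
compact `N` (`OrigamiMoserFieldLocal.lean`):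

* `exists_margin` — an open set of `ℝ × (N × ℝ)` containing `[a, b] × N × {0}` contains a product
  `(a - r, b + r) × N × (-r, r)` (tube lemma, `N` compact);
* `MoserData.exists_goodMargin` — hence a uniform `r > 0` such that on
  `(-r, 1 + r) × N × (-r, r)` the Moser field is a `C^∞` time-dependent vector field and `Ω_s` is
  non-degenerate off the zero section;
* `bump`, `MoserData.cutField` — the field cut off in time and in `t` to the compact slab
  `[-r/2, 1 + r/2] × N × [-r/2, r/2]`, equal to the Moser field on `[-r/4, 1 + r/4] × N × [-r/4, r/4]`,
  globally `C^∞` (`contMDiff_cutField`);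
* `MoserData.exists_isotopy` — the tree's flow theorem
  (`exists_ambientIsotopy_of_timeDependent_of_isCompact`, Hirsch 1976, Ch. 8 §1) integrates it
  to an ambient isotopy `Ψ` of `N × ℝ` whose tracks are integral curves of the cut field, which
  **fixes the zero section pointwise** (`apply_eq_self_of_forall_eq_zero`), and for which points
  starting in a thin band stay, for `s ∈ [0, 1]`, in the band where the cut field is the Moser
  field (`MoserData.exists_isotopy_band`).

Everything here is proved; no facts.

## References

* A. Cannas da Silva, V. Guillemin, C. Woodward, *On the unfolding of folded symplectic
  structures*, Math. Res. Lett. 7 (2000), proof of Thm. 1. [CannasGuilleminWoodward2000]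
* M. W. Hirsch, *Differential Topology* (1976), Ch. 8 §1, Thms. 1.1–1.2. [HirschDT1976]
-/

noncomputable section

open scoped Manifold ContDiff Topology Bundle
open Set Function Filter Metric
open Literature.Geometry.Kaehler Literature.Geometry.Manifold Literature.Topology.FourManifolds

namespace Literature.Geometry.Symplectic

namespace OrigamiMoser

local notation "E3" => EuclideanSpace ℝ (Fin 3)
local notation "F4" => EuclideanSpace ℝ (Fin 3) × ℝ
local notation "I34" => ModelWithCorners.prod (𝓡 3) 𝓘(ℝ, ℝ)

variable {N : Type*} [TopologicalSpace N] [ChartedSpace (EuclideanSpace ℝ (Fin 3)) N]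

/-! ### Uniform margins around the zero section -/

/-- Clamping `s ∈ (a - r, b + r)` to `[a, b]` moves it by less than `r`. [folklore] -/
theorem abs_sub_clamp_lt {a b r s : ℝ} (hab : a ≤ b) (hr : 0 < r) (hs : s ∈ Ioo (a - r) (b + r)) :
    |s - max a (min s b)| < r := by
  rcases le_total s a with hsa | has
  · have h1 : max a (min s b) = a := max_eq_left ((min_le_left s b).trans hsa)
    rw [h1, abs_sub_lt_iff]
    constructor <;> linarith [hs.1]
  · rcases le_total s b with hsb | hbs
    · have h1 : max a (min s b) = s := by rw [min_eq_left hsb, max_eq_right has]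
      rw [h1, sub_self, abs_zero]
      exact hr
    · have h1 : max a (min s b) = b := by rw [min_eq_right hbs, max_eq_right hab]
      rw [h1, abs_sub_lt_iff]
      constructor <;> linarith [hs.2]

/-- The clamp lies in `[a, b]`. [folklore] -/
theorem clamp_mem_Icc {a b s : ℝ} (hab : a ≤ b) : max a (min s b) ∈ Icc a b :=
  ⟨le_max_left _ _, max_le hab (min_le_right _ _)⟩

omit [ChartedSpace (EuclideanSpace ℝ (Fin 3)) N] in
/-- **Tube lemma around the zero section**: an open subset of `ℝ × (N × ℝ)` (`N` compact)
containing `[a, b] × N × {0}` (`a ≤ b`) contains `(a - r, b + r) × N × (-r, r)` for some `r > 0`.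
[folklore] -/
theorem exists_margin [CompactSpace N] {W : Set (ℝ × (N × ℝ))} (hW : IsOpen W) {a b : ℝ} (hab : a ≤ b)
    (hsub : ∀ s ∈ Icc a b, ∀ n : N, ((s, (n, (0 : ℝ))) : ℝ × (N × ℝ)) ∈ W) :
    ∃ r > 0, ∀ s ∈ Ioo (a - r) (b + r), ∀ (n : N) (t : ℝ), |t| < r → ((s, (n, t)) : ℝ × (N × ℝ)) ∈ W := by
  -- regroup as `((s, t), n)`
  have hgc : Continuous fun x : (ℝ × ℝ) × N => ((x.1.1, (x.2, x.1.2)) : ℝ × (N × ℝ)) :=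
    (continuous_fst.comp continuous_fst).prodMk
      (continuous_snd.prodMk (continuous_snd.comp continuous_fst))
  have hW' : IsOpen ((fun x : (ℝ × ℝ) × N => ((x.1.1, (x.2, x.1.2)) : ℝ × (N × ℝ))) ⁻¹' W) :=
    hW.preimage hgc
  have hK : IsCompact (Icc a b ×ˢ ({0} : Set ℝ)) := isCompact_Icc.prod isCompact_singleton
  have hsub' : (Icc a b ×ˢ ({0} : Set ℝ)) ×ˢ (univ : Set N) ⊆
      (fun x : (ℝ × ℝ) × N => ((x.1.1, (x.2, x.1.2)) : ℝ × (N × ℝ))) ⁻¹' W := by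
    rintro ⟨⟨s, t⟩, n⟩ ⟨⟨hs, ht⟩, -⟩
    rw [mem_singleton_iff] at ht
    subst ht
    exact hsub s hs n
  obtain ⟨u, v, hu, -, hKu, hv, huv⟩ := generalized_tube_lemma hK isCompact_univ hW' hsub'
  obtain ⟨r, hr, hthick⟩ := hK.exists_thickening_subset_open hu hKu
  refine ⟨r, hr, fun s hs n t ht => ?_⟩
  have hmem : ((s, t) : ℝ × ℝ) ∈ thickening r (Icc a b ×ˢ ({0} : Set ℝ)) := by
    rw [mem_thickening_iff]
    refine ⟨(max a (min s b), 0), ⟨clamp_mem_Icc hab, rfl⟩, ?_⟩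
    rw [Prod.dist_eq, max_lt_iff, Real.dist_eq, Real.dist_eq, sub_zero]
    exact ⟨abs_sub_clamp_lt hab hr hs, ht⟩
  exact huv (mk_mem_prod (hthick hmem) (hv (mem_univ n)))

/-! ### A two-sided smooth cut-off -/

/-- A smooth cut-off equal to `1` on `[b, c]` and to `0` off `(a, d)`, for `a < b` and `c < d`.
[folklore] -/
def bump (a b c d : ℝ) (x : ℝ) : ℝ :=
  Real.smoothTransition ((x - a) / (b - a)) * Real.smoothTransition ((d - x) / (d - c))

/-- The cut-off is `1` on `[b, c]`. [folklore] -/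
theorem bump_eq_one {a b c d x : ℝ} (hab : a < b) (hcd : c < d) (hx : x ∈ Icc b c) : bump a b c d x = 1 := by
  rw [bump, Real.smoothTransition.one_of_one_le, Real.smoothTransition.one_of_one_le, mul_one]
  · rw [le_div_iff₀ (by linarith), one_mul]; linarith [hx.2]
  · rw [le_div_iff₀ (by linarith), one_mul]; linarith [hx.1]

/-- The cut-off vanishes off `(a, d)`. [folklore] -/
theorem bump_eq_zero {a b c d x : ℝ} (hab : a < b) (hcd : c < d) (hx : x ∉ Ioo a d) : bump a b c d x = 0 := by
  rw [mem_Ioo, not_and_or, not_lt, not_lt] at hx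
  rcases hx with h | h
  · rw [bump, Real.smoothTransition.zero_of_nonpos, zero_mul]
    exact div_nonpos_of_nonpos_of_nonneg (by linarith) (by linarith)
  · rw [bump, Real.smoothTransition.zero_of_nonpos (x := (d - x) / (d - c)), mul_zero]
    exact div_nonpos_of_nonpos_of_nonneg (by linarith) (by linarith)

/-- The cut-off is smooth. [folklore] -/
theorem contDiff_bump {a b c d : ℝ} : ContDiff ℝ ∞ (bump a b c d) :=
  (Real.smoothTransition.contDiff.comp ((contDiff_id.sub contDiff_const).div_const _)).mul
    (Real.smoothTransition.contDiff.comp ((contDiff_const.sub contDiff_id).div_const _))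

/-! ### The uniform good margin and the cut-off field -/

namespace MoserData

variable [IsManifold (𝓡 3) ∞ N] (D : MoserData N)

/-- **A uniform margin** `r > 0`: on `(-r, 1 + r) × N × (-r, r)` the Moser field is a smooth
time-dependent vector field and `Ω_s` is non-degenerate off the zero section (compactness of
`[0, 1] × N × {0}` and `exists_nhds_zero_section`). [cite: CannasGuilleminWoodward2000, proof of Thm. 1] -/
theorem exists_goodMargin [CompactSpace N] :
    ∃ r > 0, (∀ s ∈ Ioo (-r) (1 + r), ∀ (n : N) (t : ℝ), |t| < r →
        ContMDiffAt (𝓘(ℝ, ℝ).prod I34) (ModelWithCorners.tangent I34) ∞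
          (fun y : ℝ × (N × ℝ) => (⟨y.2, moserField D.Ωs D.μ y.1 y.2⟩ : TangentBundle I34 (N × ℝ)))
          (s, (n, t))) ∧
      (∀ s ∈ Ioo (-r) (1 + r), ∀ (n : N) (t : ℝ), |t| < r → t ≠ 0 → pfF (D.Ωs s (n, t)) ≠ 0) := by
  -- the set of points with a good neighbourhood is open and contains `[0,1] × N × {0}`
  set W : Set (ℝ × (N × ℝ)) := {y | ∃ U : Set (ℝ × (N × ℝ)), IsOpen U ∧ y ∈ U ∧
      (∀ y' ∈ U, ContMDiffAt (𝓘(ℝ, ℝ).prod I34) (ModelWithCorners.tangent I34) ∞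
        (fun y : ℝ × (N × ℝ) => (⟨y.2, moserField D.Ωs D.μ y.1 y.2⟩ : TangentBundle I34 (N × ℝ))) y') ∧
      (∀ y' ∈ U, y'.2.2 ≠ 0 → pfF (D.Ωs y'.1 y'.2) ≠ 0)} with hWdef
  have hWo : IsOpen W := by
    rw [isOpen_iff_mem_nhds]
    rintro y ⟨U, hUo, hyU, h1, h2⟩
    exact mem_of_superset (hUo.mem_nhds hyU) fun y' hy' => ⟨U, hUo, hy', h1, h2⟩
  have hsub : ∀ s ∈ Icc (0 : ℝ) 1, ∀ n : N, ((s, (n, (0 : ℝ))) : ℝ × (N × ℝ)) ∈ W := by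
    intro s hs n
    obtain ⟨U, hU, h1, h2⟩ := D.exists_nhds_zero_section n hs
    obtain ⟨U', hU'U, hU'o, hyU'⟩ := mem_nhds_iff.1 hU
    exact ⟨U', hU'o, hyU', fun y' hy' => h1 y' (hU'U hy'), fun y' hy' => h2 y' (hU'U hy')⟩
  obtain ⟨r, hr, hmar⟩ := exists_margin hWo zero_le_one hsub
  refine ⟨r, hr, fun s hs n t ht => ?_, fun s hs n t ht ht0 => ?_⟩
  · have hs' : s ∈ Ioo (0 - r) (1 + r) := by simpa using hs
    obtain ⟨U, -, hyU, h1, -⟩ := hmar s hs' n t ht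
    exact h1 (s, (n, t)) hyU
  · have hs' : s ∈ Ioo (0 - r) (1 + r) := by simpa using hs
    obtain ⟨U, -, hyU, -, h2⟩ := hmar s hs' n t ht
    exact h2 (s, (n, t)) hyU ht0

/-- A chosen good margin. [folklore] -/
def margin [CompactSpace N] : ℝ := Classical.choose D.exists_goodMargin

/-- The margin is positive. [folklore] -/
theorem margin_pos [CompactSpace N] : 0 < D.margin := (Classical.choose_spec D.exists_goodMargin).1

/-- On the good region the Moser field is smooth. [folklore] -/
theorem contMDiffAt_field [CompactSpace N] {s : ℝ} (hs : s ∈ Ioo (-D.margin) (1 + D.margin))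
    (n : N) {t : ℝ} (ht : |t| < D.margin) :
    ContMDiffAt (𝓘(ℝ, ℝ).prod I34) (ModelWithCorners.tangent I34) ∞
      (fun y : ℝ × (N × ℝ) => (⟨y.2, moserField D.Ωs D.μ y.1 y.2⟩ : TangentBundle I34 (N × ℝ)))
      (s, (n, t)) :=
  (Classical.choose_spec D.exists_goodMargin).2.1 s hs n t ht

/-- On the good region `Ω_s` is non-degenerate off the zero section. [folklore] -/
theorem pfF_ne_zero [CompactSpace N] {s : ℝ} (hs : s ∈ Ioo (-D.margin) (1 + D.margin))
    (n : N) {t : ℝ} (ht : |t| < D.margin) (ht0 : t ≠ 0) : pfF (D.Ωs s (n, t)) ≠ 0 :=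
  (Classical.choose_spec D.exists_goodMargin).2.2 s hs n t ht ht0

/-- **The Moser equation on the good region**: `Ω_s (X_s, u) = -μ(u)` at `(n, t)` with
`|t| < r`, `s ∈ (-r, 1 + r)` (off the zero section by non-degeneracy, on it both sides vanish).
[cite: McDuffSalamon2017, §3.2] -/
theorem moser_equation [CompactSpace N] {s : ℝ} (hs : s ∈ Ioo (-D.margin) (1 + D.margin))
    (n : N) {t : ℝ} (ht : |t| < D.margin) (u : F4) :
    D.Ωs s (n, t) ![moserField D.Ωs D.μ s (n, t), u] = -(D.μ (n, t) ![u]) := by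
  by_cases ht0 : t = 0
  · subst ht0
    rw [D.moserField_zero_section, D.μ_zero, D.Ωs_zero_section]
    exact ((D.Ω₀ (n, 0)).map_coord_zero (m := ![(0 : TangentSpace I34 ((n, (0 : ℝ)) : N × ℝ)), u]) 0
      rfl).trans (by simp)
  · exact apply_moserField _ _ (D.pfF_ne_zero hs n ht ht0) u

variable [CompactSpace N]

/-- The scalar cut-off `κ(s) χ(t)`: `1` on `[-r/4, 1 + r/4] × [-r/4, r/4]`, `0` off
`(-r/2, 1 + r/2) × (-r/2, r/2)`. [folklore] -/
def cutScalar (y : ℝ × (N × ℝ)) : ℝ :=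
  bump (-(D.margin / 2)) (-(D.margin / 4)) (1 + D.margin / 4) (1 + D.margin / 2) y.1 *
    bump (-(D.margin / 2)) (-(D.margin / 4)) (D.margin / 4) (D.margin / 2) y.2.2

/-- The scalar cut-off is smooth. [folklore] -/
theorem contMDiff_cutScalar : ContMDiff (𝓘(ℝ, ℝ).prod I34) 𝓘(ℝ, ℝ) ∞ D.cutScalar :=
  (contDiff_bump.contMDiff.comp contMDiff_fst).mul
    (contDiff_bump.contMDiff.comp (contMDiff_snd.comp contMDiff_snd))

/-- The scalar cut-off is `1` on the inner region. [folklore] -/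
theorem cutScalar_eq_one {y : ℝ × (N × ℝ)} (h1 : y.1 ∈ Icc (-(D.margin / 4)) (1 + D.margin / 4))
    (h2 : y.2.2 ∈ Icc (-(D.margin / 4)) (D.margin / 4)) : D.cutScalar y = 1 := by
  have hr := D.margin_pos
  rw [cutScalar, bump_eq_one (by linarith) (by linarith) h1, bump_eq_one (by linarith) (by linarith) h2,
    mul_one]

/-- The scalar cut-off vanishes off the outer region. [folklore] -/
theorem cutScalar_eq_zero {y : ℝ × (N × ℝ)}
    (h : y.1 ∉ Ioo (-(D.margin / 2)) (1 + D.margin / 2) ∨ y.2.2 ∉ Ioo (-(D.margin / 2)) (D.margin / 2)) :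
    D.cutScalar y = 0 := by
  have hr := D.margin_pos
  rcases h with h | h
  · rw [cutScalar, bump_eq_zero (by linarith) (by linarith) h, zero_mul]
  · rw [cutScalar, bump_eq_zero (x := y.2.2) (by linarith) (by linarith) h, mul_zero]

/-- **The cut-off Moser field** `(s, p) ↦ κ(s) χ(t) X_s(p)`. [folklore] -/
def cutField (y : ℝ × (N × ℝ)) : TangentSpace I34 y.2 := D.cutScalar y • moserField D.Ωs D.μ y.1 y.2

/-- The cut-off field is the Moser field on the inner region. [folklore] -/
theorem cutField_eq {y : ℝ × (N × ℝ)} (h1 : y.1 ∈ Icc (-(D.margin / 4)) (1 + D.margin / 4))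
    (h2 : y.2.2 ∈ Icc (-(D.margin / 4)) (D.margin / 4)) : D.cutField y = moserField D.Ωs D.μ y.1 y.2 := by
  rw [cutField, D.cutScalar_eq_one h1 h2, one_smul]

/-- The cut-off field vanishes off the slab `[-r/2, 1 + r/2] × (N × [-r/2, r/2])`. [folklore] -/
theorem cutField_eq_zero {y : ℝ × (N × ℝ)}
    (h : y.1 ∉ Icc (-(D.margin / 2)) (1 + D.margin / 2) ∨ y.2 ∉ (univ : Set N) ×ˢ Icc (-(D.margin / 2)) (D.margin / 2)) :
    D.cutField y = 0 := by
  rw [cutField, D.cutScalar_eq_zero, zero_smul]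
  rcases h with h | h
  · exact Or.inl fun h' => h (Ioo_subset_Icc_self h')
  · refine Or.inr fun h' => h ⟨mem_univ _, Ioo_subset_Icc_self h'⟩

/-- The cut-off field vanishes on the zero section. [folklore] -/
theorem cutField_zero_section (s : ℝ) (n : N) : D.cutField (s, (n, 0)) = 0 := by
  rw [cutField]
  show D.cutScalar (s, (n, 0)) • moserField D.Ωs D.μ s (n, 0) = 0
  rw [D.moserField_zero_section, smul_zero]

/-- **The cut-off Moser field is a smooth time-dependent vector field on all of `ℝ × (N × ℝ)`.**
[folklore] -/
theorem contMDiff_cutField : ContMDiff (𝓘(ℝ, ℝ).prod I34) (ModelWithCorners.tangent I34) ∞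
    (fun y : ℝ × (N × ℝ) => (⟨y.2, D.cutField y⟩ : TangentBundle I34 (N × ℝ))) := by
  have hr := D.margin_pos
  intro y
  by_cases hin : y.1 ∈ Ioo (-D.margin) (1 + D.margin) ∧ |y.2.2| < D.margin
  · -- in the good region: scalar times the smooth Moser field
    have hV := D.contMDiffAt_field hin.1 y.2.1 hin.2
    have hV' : ContMDiffAt (𝓘(ℝ, ℝ).prod I34) (ModelWithCorners.tangent I34) ∞
        (fun y : ℝ × (N × ℝ) => (⟨y.2, moserField D.Ωs D.μ y.1 y.2⟩ : TangentBundle I34 (N × ℝ))) y := by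
      have : y = (y.1, (y.2.1, y.2.2)) := by simp
      rw [this]; exact hV
    exact (ContMDiffWithinAt.smul_tangentVector (s := univ)
      (D.contMDiff_cutScalar y).contMDiffWithinAt hV'.contMDiffWithinAt).contMDiffAt univ_mem
  · -- outside: the field vanishes near `y`
    have hout : ∀ᶠ y' in 𝓝 y, D.cutScalar y' = 0 := by
      rw [not_and_or] at hin
      rcases hin with h | h
      · have hc : IsClosed {y' : ℝ × (N × ℝ) | y'.1 ∈ Icc (-(D.margin / 2)) (1 + D.margin / 2)} :=
          isClosed_Icc.preimage continuous_fst
        have hy : y ∉ {y' : ℝ × (N × ℝ) | y'.1 ∈ Icc (-(D.margin / 2)) (1 + D.margin / 2)} := by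
          intro h'
          apply h
          exact ⟨by linarith [h'.1], by linarith [h'.2]⟩
        filter_upwards [hc.isOpen_compl.mem_nhds hy] with y' hy'
        exact D.cutScalar_eq_zero (Or.inl fun h'' => hy' (Ioo_subset_Icc_self h''))
      · have hc : IsClosed {y' : ℝ × (N × ℝ) | y'.2.2 ∈ Icc (-(D.margin / 2)) (D.margin / 2)} :=
          isClosed_Icc.preimage (continuous_snd.comp continuous_snd)
        have hy : y ∉ {y' : ℝ × (N × ℝ) | y'.2.2 ∈ Icc (-(D.margin / 2)) (D.margin / 2)} := by
          intro h'
          apply h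
          rw [abs_lt]
          exact ⟨by linarith [h'.1], by linarith [h'.2]⟩
        filter_upwards [hc.isOpen_compl.mem_nhds hy] with y' hy'
        exact D.cutScalar_eq_zero (Or.inr fun h'' => hy' (Ioo_subset_Icc_self h''))
    have hev : (fun y' : ℝ × (N × ℝ) => (⟨y'.2, D.cutField y'⟩ : TangentBundle I34 (N × ℝ))) =ᶠ[𝓝 y]
        fun y' => (⟨y'.2, 0⟩ : TangentBundle I34 (N × ℝ)) := by
      filter_upwards [hout] with y' hy'
      show (⟨y'.2, D.cutScalar y' • moserField D.Ωs D.μ y'.1 y'.2⟩ : TangentBundle I34 (N × ℝ)) = _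
      rw [hy', zero_smul]
    refine ContMDiffAt.congr_of_eventuallyEq ?_ hev
    exact (Bundle.contMDiff_zeroSection ℝ (TangentSpace I34 : N × ℝ → Type _)).contMDiffAt.comp y
      contMDiffAt_snd

/-! ### The isotopy -/

variable [T2Space N]

/-- **The cut-off Moser field integrates to an ambient isotopy of `N × ℝ`** whose tracks are its
integral curves (Hirsch 1976, Ch. 8 §1, Thm. 1.2, for the compact slab
`[-r/2, 1 + r/2] × N × [-r/2, r/2]`). [cite: HirschDT1976, Ch. 8 §1, Thm. 1.2] -/
theorem exists_isotopy : ∃ Ψ : AmbientIsotopy I34 (N × ℝ),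
    ∀ y, IsMIntegralCurve (I := 𝓘(ℝ, ℝ).prod I34) (fun s => ((s, Ψ.toFun s y) : ℝ × (N × ℝ)))
      (fun p : ℝ × (N × ℝ) => (((1 : ℝ), D.cutField p) : TangentSpace (𝓘(ℝ, ℝ).prod I34) p)) :=
  SlabFlow.exists_ambientIsotopy_of_timeDependent_of_isCompact D.contMDiff_cutField
    (isCompact_univ.prod isCompact_Icc) fun _ hp => D.cutField_eq_zero hp

/-- A chosen Moser isotopy. [folklore] -/
def isotopy : AmbientIsotopy I34 (N × ℝ) := Classical.choose D.exists_isotopy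

/-- The tracks of the Moser isotopy are integral curves of the cut-off field. [folklore] -/
theorem isotopy_track (y : N × ℝ) :
    IsMIntegralCurve (I := 𝓘(ℝ, ℝ).prod I34) (fun s => ((s, D.isotopy.toFun s y) : ℝ × (N × ℝ)))
      (fun p : ℝ × (N × ℝ) => (((1 : ℝ), D.cutField p) : TangentSpace (𝓘(ℝ, ℝ).prod I34) p)) :=
  Classical.choose_spec D.exists_isotopy y

/-- **The Moser isotopy fixes the zero section pointwise.** [cite: CannasGuilleminWoodward2000, proof of Thm. 1] -/
theorem isotopy_zero_section (s : ℝ) (n : N) : D.isotopy.toFun s (n, 0) = (n, 0) :=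
  SlabFlow.apply_eq_self_of_forall_eq_zero D.contMDiff_cutField D.isotopy_track
    (fun s' => D.cutField_zero_section s' n) s

/-- **Thin bands stay in the inner region**: there is `δ > 0` such that points with `|t| < δ`
stay, for `s ∈ [0, 1]`, in the band `|t| < r/4` where the cut-off field is the Moser field
(continuity of the isotopy on the compact `[0, 1] × N × {0}`, which it fixes). [folklore] -/
theorem exists_isotopy_band : ∃ δ > 0, δ ≤ D.margin / 4 ∧ ∀ s ∈ Icc (0 : ℝ) 1, ∀ (n : N) (t : ℝ), |t| < δ →
    |(D.isotopy.toFun s (n, t)).2| < D.margin / 4 := by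
  have hr := D.margin_pos
  set W : Set (ℝ × (N × ℝ)) := {y | |(D.isotopy.toFun y.1 y.2).2| < D.margin / 4} with hW
  have hcont : Continuous fun y : ℝ × (N × ℝ) => (D.isotopy.toFun y.1 y.2).2 :=
    continuous_snd.comp D.isotopy.contMDiff.continuous
  have hWo : IsOpen W := isOpen_lt (continuous_abs.comp hcont) continuous_const
  have hsub : ∀ s ∈ Icc (0 : ℝ) 1, ∀ n : N, ((s, (n, (0 : ℝ))) : ℝ × (N × ℝ)) ∈ W := by
    intro s _ n
    show |(D.isotopy.toFun s (n, 0)).2| < D.margin / 4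
    rw [D.isotopy_zero_section]
    simpa using by positivity
  obtain ⟨r', hr', hmar⟩ := exists_margin hWo zero_le_one hsub
  refine ⟨min r' (D.margin / 4), lt_min hr' (by positivity), min_le_right _ _, fun s hs n t ht => ?_⟩
  have h := hmar s ⟨by linarith [hs.1], by linarith [hs.2]⟩ n t (lt_of_lt_of_le ht (min_le_left _ _))
  exact h

end MoserData

end OrigamiMoser

end Literature.Geometry.Symplectic

end
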